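import Mathlib
import Literature.Computability.Complexity.CircuitComposition
import HarnessLib

/-!
# Gap-MCSP window cell `q = 0` (trade-off law) — I. Rooted `B₂`-formulas

Part of the tree landing of HOME/decomp-pnenp-lens-1/TradeOffLaw.lean (sha256 880b490f…, lens-1 g13 of the decomp-pnenp root-decomposition cell; critic NODE-VERDICT 2026-08-30T13:09:32Z CLEARED, landing endorsed (6)(a)):
a SIZE–ACCEPTANCE TRADE-OFF for every `B₂`-circuit on `N` inputs that accepts `0^N` and every point
indicator `e_p` — `N ≤ 9·L·(L + G + 3 − N)`, `L = ⌊log₂ acc⌋`, `G` = number of gates — and its payout: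
the Oliveira–Pich–Santhanam gap problem `Gap-MCSP[2^{βn}/(cn), 2^{βn}]` (census R3) is not separated by
`B₂`-circuit families of eventually `≤ N` gates (`0 < β < 1/3`, every `c ≥ 1`), i.e. the `q = 0` cell of
the window dial of route `route-PneNP-RootDecompMagnificationPayout` (item stmt-PneNP-33309 `WindowCellZero`,
BC5 rung for the attacked item stmt-PneNP-32096). Modules, in dependency order: `…Formulas` (rooted
`B₂`-formulas and additive valuations) → `…Counting` (uniform counting, silent/flipping variables, numeric
helpers) → `…FlipLaw` (the exact acceptance law for read-once formulas) → `…Unfolding` (rooted unfolding of a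
gate list, consistency, references) → `…Potential` (variables/nodes of unfoldings, the root potential: no
duplication across root formulas) → `…Relevance` (relevant roots, link, locality) → `…Product` (boxes, the two
exponent bounds, pigeonhole, the final arithmetic) → `…Count` (`t + 2·nocc ≤ 2G + 3`) → `GapMCSPWindowCellZero`
(the law proved, the payout in tree vocabulary). Proof-internal machinery: nothing here bears on P vs NP
beyond the S-free lower bound it proves; all statements are [folklore]-tagged kernel lemmas of the lens.

THIS FILE (lens §2, first half): the inductive type `BF N` of `B₂`-formula trees with literal, constant and
REFERENCE leaves and indexed binary gates; evaluation in an environment of cut-wire values; variables,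
references, gate nodes; a general additive valuation `val ℓ κ` with its instances (read multiplicity, node
multiplicity, leaf and node counts); the tree-shape inequality `#lit + #ref ≤ #gates + 1`; read-once formulas.
-/

noncomputable section

set_option linter.dupNamespace false -- `Summit.PneNP.PneNP.…`: summit = sub-problem name (D-0017 single-conjunct layout)

namespace Summit.PneNP.PneNP.Theorems.GapMCSPWindowCellZero

open Literature.Computability.Complexity

section Formulas

open Finset

variable {N : ℕ}

/-- Boolean formulas over `B₂` on `N` variables with literal leaves, constant leaves, REFERENCE
leaves `ref w` (the value of a cut wire `w`, read from an environment `ρ`) and binary gates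
carrying the index `j` of the circuit gate they unfold. [folklore] -/
inductive BF (N : ℕ) : Type
  | lit (p : Fin N) (b : Bool) : BF N
  | cst (b : Bool) : BF N
  | ref (w : Fin N ⊕ ℕ) : BF N
  | gate (j : ℕ) (g : Bool → Bool → Bool) (l r : BF N) : BF N

namespace BF

/-- Evaluation in the environment `ρ` of cut-wire values (`lit p b` is the literal `[x p = b]`).
[folklore] -/
def eval (ρ : Fin N ⊕ ℕ → Bool) : BF N → (Fin N → Bool) → Bool
  | lit p b, x => x p == b
  | cst b, _ => b
  | ref w, _ => ρ w
  | gate _ g l r, x => g (eval ρ l x) (eval ρ r x)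

/-- The set of variables read by literal leaves. [folklore] -/
def vars : BF N → Finset (Fin N)
  | lit p _ => {p}
  | cst _ => ∅
  | ref _ => ∅
  | gate _ _ l r => l.vars ∪ r.vars

/-- The set of cut wires read by reference leaves. [folklore] -/
def refs : BF N → Finset (Fin N ⊕ ℕ)
  | lit _ _ => ∅
  | cst _ => ∅
  | ref w => {w}
  | gate _ _ l r => l.refs ∪ r.refs

/-- The set of indices of gate nodes. [folklore] -/
def nodes : BF N → Finset ℕ
  | lit _ _ => ∅
  | cst _ => ∅
  | ref _ => ∅
  | gate j _ l r => insert j (l.nodes ∪ r.nodes)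

/-- A general ADDITIVE VALUATION: weight `ℓ p` per literal leaf on `p`, `κ j` per gate node of
index `j` (constants and references weigh `0`). [folklore] -/
def val (ℓ : Fin N → ℕ) (κ : ℕ → ℕ) : BF N → ℕ
  | lit p _ => ℓ p
  | cst _ => 0
  | ref _ => 0
  | gate j _ l r => κ j + val ℓ κ l + val ℓ κ r

/-- Read multiplicity of the variable `p`. [folklore] -/
def mult (p : Fin N) (F : BF N) : ℕ := F.val (fun q => if q = p then 1 else 0) (fun _ => 0)

/-- Multiplicity of the gate index `j` among the gate nodes. [folklore] -/
def gmult (j : ℕ) (F : BF N) : ℕ := F.val (fun _ => 0) (fun j' => if j' = j then 1 else 0)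

/-- Number of literal leaves. [folklore] -/
def nlits (F : BF N) : ℕ := F.val (fun _ => 1) (fun _ => 0)

/-- Number of gate nodes. [folklore] -/
def ngates (F : BF N) : ℕ := F.val (fun _ => 0) (fun _ => 1)

/-- Number of reference leaves. [folklore] -/
def nrefs : BF N → ℕ
  | lit _ _ => 0
  | cst _ => 0
  | ref _ => 1
  | gate _ _ l r => l.nrefs + r.nrefs

/-- Read-once: the two children of every gate read disjoint sets of variables. [folklore] -/
def ReadOnce : BF N → Prop
  | lit _ _ => True
  | cst _ => True
  | ref _ => True
  | gate _ _ l r => l.ReadOnce ∧ r.ReadOnce ∧ Disjoint l.vars r.vars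

/-- `val` of a literal leaf is its literal weight. -/
@[simp] theorem val_lit (ℓ : Fin N → ℕ) (κ : ℕ → ℕ) (p : Fin N) (b : Bool) :
    (lit p b : BF N).val ℓ κ = ℓ p := rfl
/-- `val` of a constant leaf is `0`. -/
@[simp] theorem val_cst (ℓ : Fin N → ℕ) (κ : ℕ → ℕ) (b : Bool) : (cst b : BF N).val ℓ κ = 0 := rfl
/-- `val` of a reference leaf is `0`. -/
@[simp] theorem val_ref (ℓ : Fin N → ℕ) (κ : ℕ → ℕ) (w : Fin N ⊕ ℕ) : (ref w : BF N).val ℓ κ = 0 := rfl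
/-- `val` of a gate node: its node weight plus the values of the two children. -/
@[simp] theorem val_gate (ℓ : Fin N → ℕ) (κ : ℕ → ℕ) (j : ℕ) (g : Bool → Bool → Bool) (l r : BF N) :
    (gate j g l r).val ℓ κ = κ j + l.val ℓ κ + r.val ℓ κ := rfl

/-- Evaluation depends on the input only through the variables read by literal leaves. [folklore] -/
theorem eval_congr (ρ : Fin N ⊕ ℕ → Bool) (F : BF N) {x y : Fin N → Bool}
    (h : ∀ p ∈ F.vars, x p = y p) : F.eval ρ x = F.eval ρ y := by
  induction F with
  | lit p b => simp [eval, h p (by simp [vars])]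
  | cst b => rfl
  | ref w => rfl
  | gate j g l r ihl ihr =>
    simp only [eval]
    rw [ihl (fun p hp => h p (by simp [vars, hp])), ihr (fun p hp => h p (by simp [vars, hp]))]

/-- Evaluation depends on the environment only through the referenced wires. [folklore] -/
theorem eval_congr_ref {ρ ρ' : Fin N ⊕ ℕ → Bool} (F : BF N) (h : ∀ w ∈ F.refs, ρ w = ρ' w)
    (x : Fin N → Bool) : F.eval ρ x = F.eval ρ' x := by
  induction F with
  | lit p b => rfl
  | cst b => rfl
  | ref w => simpa [eval] using h w (by simp [refs])
  | gate j g l r ihl ihr =>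
    simp only [eval]
    rw [ihl (fun w hw => h w (by simp [refs, hw])), ihr (fun w hw => h w (by simp [refs, hw]))]

/-- A variable is read iff its read multiplicity is positive. [folklore] -/
theorem mem_vars_iff_mult (F : BF N) (p : Fin N) : p ∈ F.vars ↔ 0 < F.mult p := by
  unfold mult
  induction F with
  | lit q b =>
    simp only [vars, mem_singleton, val_lit]
    by_cases h : q = p
    · subst h; simp
    · have h' : p ≠ q := fun e => h e.symm
      simp [h, h']
  | cst b => simp [vars]
  | ref w => simp [vars]
  | gate j g l r ihl ihr => simp [vars, ihl, ihr]

/-- A gate index is a node iff its node multiplicity is positive. [folklore] -/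
theorem mem_nodes_iff_gmult (F : BF N) (j : ℕ) : j ∈ F.nodes ↔ 0 < F.gmult j := by
  unfold gmult
  induction F with
  | lit q b => simp [nodes]
  | cst b => simp [nodes]
  | ref w => simp [nodes]
  | gate j' g l r ihl ihr =>
    simp only [nodes, mem_insert, mem_union, val_gate]
    by_cases h : j' = j
    · subst h; simp
    · have h' : j ≠ j' := fun e => h e.symm
      simp [h, h', ihl, ihr]

/-- The number of distinct variables is at most the number of literal leaves. [folklore] -/
theorem card_vars_le_nlits (F : BF N) : F.vars.card ≤ F.nlits := by
  unfold nlits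
  induction F with
  | lit q b => simp [vars]
  | cst b => simp [vars]
  | ref w => simp [vars]
  | gate j g l r ihl ihr =>
    simp only [vars, val_gate, zero_add]
    exact (card_union_le _ _).trans (Nat.add_le_add ihl ihr)

/-- The number of distinct references is at most the number of reference leaves. [folklore] -/
theorem card_refs_le_nrefs (F : BF N) : F.refs.card ≤ F.nrefs := by
  induction F with
  | lit q b => simp [refs, nrefs]
  | cst b => simp [refs, nrefs]
  | ref w => simp [refs, nrefs]
  | gate j g l r ihl ihr =>
    simp only [refs, nrefs]
    exact (card_union_le _ _).trans (Nat.add_le_add ihl ihr)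

/-- TREE SHAPE: a binary tree has at most one more (literal or reference) leaf than gate nodes.
[folklore] -/
theorem nlits_add_nrefs_le (F : BF N) : F.nlits + F.nrefs ≤ F.ngates + 1 := by
  unfold nlits ngates
  induction F with
  | lit q b => simp [nrefs]
  | cst b => simp [nrefs]
  | ref w => simp [nrefs]
  | gate j g l r ihl ihr =>
    simp only [val_gate, nrefs, zero_add]
    omega

/-- If no index occurs twice among the gate nodes, the node count is the size of the node set.
[folklore] -/
theorem ngates_eq_card_nodes (F : BF N) (h : ∀ j, F.gmult j ≤ 1) : F.ngates = F.nodes.card := by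
  unfold ngates
  induction F with
  | lit q b => simp [nodes]
  | cst b => simp [nodes]
  | ref w => simp [nodes]
  | gate j g l r ihl ihr =>
    have hl : ∀ j', l.gmult j' ≤ 1 := fun j' => by
      have := h j'; simp only [gmult, val_gate] at this ⊢; omega
    have hr : ∀ j', r.gmult j' ≤ 1 := fun j' => by
      have := h j'; simp only [gmult, val_gate] at this ⊢; omega
    have hjl : j ∉ l.nodes := fun hj => by
      have h1 := (mem_nodes_iff_gmult l j).1 hj
      have := h j
      simp only [gmult, val_gate, if_true] at this h1
      omega
    have hjr : j ∉ r.nodes := fun hj => by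
      have h1 := (mem_nodes_iff_gmult r j).1 hj
      have := h j
      simp only [gmult, val_gate, if_true] at this h1
      omega
    have hdisj : Disjoint l.nodes r.nodes := by
      rw [Finset.disjoint_left]
      intro j' hj'l hj'r
      have h1 := (mem_nodes_iff_gmult l j').1 hj'l
      have h2 := (mem_nodes_iff_gmult r j').1 hj'r
      have := h j'
      simp only [gmult, val_gate] at this h1 h2
      omega
    simp only [val_gate, nodes]
    rw [card_insert_of_notMem (by simp [hjl, hjr]), card_union_of_disjoint hdisj, ihl hl, ihr hr]
    omega

/-- Multiplicity `≤ 1` everywhere gives read-once. [folklore] -/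
theorem readOnce_of_mult_le_one (F : BF N) (h : ∀ p, F.mult p ≤ 1) : F.ReadOnce := by
  induction F with
  | lit q b => trivial
  | cst b => trivial
  | ref w => trivial
  | gate j g l r ihl ihr =>
    refine ⟨ihl (fun p => ?_), ihr (fun p => ?_), ?_⟩
    · have := h p; simp only [mult, val_gate] at this ⊢; omega
    · have := h p; simp only [mult, val_gate] at this ⊢; omega
    · rw [Finset.disjoint_left]
      intro p hpl hpr
      have h1 := (mem_vars_iff_mult l p).1 hpl
      have h2 := (mem_vars_iff_mult r p).1 hpr
      have := h p
      simp only [mult, val_gate] at this h1 h2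
      omega

end BF

end Formulas

end Summit.PneNP.PneNP.Theorems.GapMCSPWindowCellZero
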